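import Literature.Computability.QuantumComplexity.PhaseQueryState
import Literature.Computability.Cryptography.QuantumCircuitProofs
import Literature.Computability.Cryptography.QubitRegisterCliffordTProofs
import HarnessLib

/-!
# Phase-query families, IV: the acceptance probability

Fourth file of the construction (`PhaseQueryOps/Layout/State.lean`). For parameters `P` with a
specification `S : Spec P` and an input `x` (length `N`), the circuit `bigCirc P N` run on
`|x⟩|0…0⟩` is followed through its stages in the product-state calculus of `CircuitEmbedding.lean`:

* the three query registers are the blocks `E c : Fin Wq ↪ Fin TW`; after the mask stage the
  register holds the basis state `zPreF` (`pre_mulVec`), all blocks zero, i.e. the product state of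
  three copies of `|0^{Wq}⟩`;
* Hadamard layer `j` multiplies every block factor by `Hm j` — the Hadamard gates on the wires
  `t < Wv x` if `j < Kv x`, nothing otherwise (`hLayer_mulVec`); the phase macros of layer `j`
  multiply every factor by the diagonal sign `Dg j` of the phase predicate `S.Pf x · j`
  (`pLayer_mulVec`, a diagonal macro in the sense of `PhaseQueryOps.mulVec_prodState_of_diag`:
  opening, `Z` on the phase bit, closing = opening⁻¹);
* so after all layers every factor is `φfin = Hm Ly · Dg Ly · Hm (Ly-1) ⋯ Dg 1 · Hm 0 |0^{Wq}⟩`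
  (`layers_mulVec`) — the Forrelation circuit of Aaronson–Ambainis, §3.2, Fig. 2 (`H^{⊗n} U_{f_k} ⋯
  U_{f_1} H^{⊗n}`) padded with inactive layers;
* the zero test permutes basis states and writes `[some register is zero]` on wire `0`
  (`post_zero`), whence, the Born weights of a product state being the product distribution
  (`CircuitEmbedding.sum_normSq_prodState_mul`), **the acceptance probability is
  `1 − (1 − |⟨0^{Wq}|φfin⟩|²)³`** (`acceptProbOn_family`; Aaronson–Ambainis §6, p. 26: accept iff a
  run returns to the all-zero state, here OR-amplified over three independent runs).

## References

* S. Aaronson, A. Ambainis, *Forrelation*, SIAM J. Comput. 47 (2018), §3.2 (Fig. 2), §6 (p. 26,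
  Prop. 6) [AaronsonAmbainis2018].
* M. A. Nielsen, I. L. Chuang, *Quantum Computation and Quantum Information*, CUP 2010, §2.1.7
  eq. (2.45), §2.2.8, §4.3, §6.1.1 [NielsenChuang2010].
-/

noncomputable section

namespace Literature.Computability.QuantumComplexity

open _root_.Computability Complexity Cryptography Matrix Finset RevSim RevClean RazTalMachine Turing

namespace PhaseQuery

open scoped Classical

variable (P : Params) (S : Spec P) (x : List Bool) (A : Language Bool)

local notation "N" => x.length

/-! ### The blocks -/

section Blocks

/-- **Block `c`: the query register of copy `c`.** [folklore] -/
def E (c : Fin 3) : Fin (Wq P N) ↪ Fin (TW P N) :=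
  ⟨fun t => ⟨qW P N c t, lt_TW_of_lt_D P N (qW_lt_D P N c.isLt t.isLt)⟩, fun t t' h => by
    have := (qW_inj P N t.isLt t'.isLt (congrArg Fin.val h)).2
    exact Fin.ext this⟩

/-- The wire of `E c t`. [folklore] -/
@[simp] theorem val_E (c : Fin 3) (t : Fin (Wq P N)) : (E P x c t : ℕ) = qW P N c t := rfl

/-- The blocks are pairwise disjoint. [folklore] -/
theorem blockDisjoint_E : BlockDisjoint (E P x) := by
  intro i j hij
  refine Set.disjoint_left.2 ?_
  rintro w ⟨t, rfl⟩ ⟨t', h⟩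
  have := (qW_inj P N t'.isLt t.isLt (congrArg Fin.val h)).1
  exact hij (Fin.ext this).symm

/-- A wire is off the blocks iff it is not a query wire. [folklore] -/
theorem offBlocks_iff (w : Fin (TW P N)) : OffBlocks (E P x) w ↔ ((w : ℕ) < N ∨ N + 3 * Wq P N ≤ (w : ℕ)) := by
  constructor
  · intro h
    by_contra hw
    push Not at hw
    have hWq : 0 < Wq P N := by omega
    set r := (w : ℕ) - N
    have hc : r / Wq P N < 3 := Nat.div_lt_of_lt_mul (by omega)
    have ht : r % Wq P N < Wq P N := Nat.mod_lt _ hWq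
    apply h ⟨r / Wq P N, hc⟩ ⟨⟨r % Wq P N, ht⟩, Fin.ext ?_⟩
    change N + (r / Wq P N) * Wq P N + r % Wq P N = (w : ℕ)
    have := Nat.div_add_mod r (Wq P N)
    rw [Nat.mul_comm]; omega
  · rintro h c ⟨t, ht⟩
    have h1 := qW_lt P N c.isLt t.isLt
    have h2 := N_le_qW P N c t
    have : (w : ℕ) = qW P N c t := by rw [← ht]; rfl
    omega

/-- Query wires are on the blocks. [folklore] -/
theorem not_offBlocks_qW (c : Fin 3) (t : Fin (Wq P N)) : ¬ OffBlocks (E P x) (E P x c t) :=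
  fun h => h c ⟨t, rfl⟩

end Blocks

/-! ### The state after the mask stage, and the data of the states in its support -/

section PreState

/-- **The register after the mask stage** (a basis state). [folklore] -/
def zPreF : QReg (TW P N) := fun p => cleanW P x (dfun P x q0 0 0 false false) (topPre P x S) p

/-- The query registers of a label `z`, read through the blocks. [folklore] -/
def qOf (z : QReg (TW P N)) : ℕ → ℕ → Bool := fun c t => liftW z (qW P N c t)

/-- The query register of copy `c` of `z`, as a list, is `z` read along block `c`. [folklore] -/
theorem qlist_qOf' (z : QReg (TW P N)) {c : ℕ} (hc : c < 3) : qlist P x (qOf P x z) c = List.ofFn (z ∘ E P x ⟨c, hc⟩) := by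
  unfold qlist qOf
  congr 1
  funext t
  simp only [Function.comp_apply]
  rw [show qW P N c t = (E P x ⟨c, hc⟩ t : ℕ) from rfl, liftW_val]

/-- The same for `c : Fin 3`. [folklore] -/
theorem qlist_qOf (z : QReg (TW P N)) (c : Fin 3) : qlist P x (qOf P x z) c = List.ofFn (z ∘ E P x c) :=
  qlist_qOf' P x z c.isLt

/-- **The data of a label in the support.** A label agreeing with `zPreF` off the blocks is the
clean assignment with the same masks and its own query registers.
[folklore] -/
theorem liftW_eq_cleanW_of_agree {z : QReg (TW P N)} (hz : ∀ w, OffBlocks (E P x) w → z w = zPreF P S x w) :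
    liftW z = cleanW P x (dfun P x (qOf P x z) 0 0 false false) (topPre P x S) := by
  funext p
  by_cases hp : p < TW P N
  swap
  · have h1 : Wblk P N ≤ p := by have := Wblk_lt_TW P N; omega
    have h2 : ¬ p < Wblk P N + Wq P N + Ly P N + 1 := by rw [TW_eq'] at hp; omega
    have h3 : ¬ p < Wblk P N + Wq P N := by omega
    simp only [liftW, hp, dif_neg, not_false_eq_true, cleanW, h1, if_true, topPre, topF, h3, h2, if_false]
    rw [if_neg (by unfold aW; rw [TW_eq'] at hp; omega), if_neg (by unfold oW; rw [TW_eq'] at hp; omega)]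
  rw [liftW_of_lt z hp]
  by_cases hoff : (p < N ∨ N + 3 * Wq P N ≤ p)
  · rw [hz ⟨p, hp⟩ ((offBlocks_iff P x ⟨p, hp⟩).2 hoff)]
    simp only [zPreF, cleanW, dfun]
    rcases hoff with h | h
    · simp [h]
    · have h' : ¬ p < N + 3 * Wq P N := by omega
      have h'' : ¬ p < N := by omega
      simp only [h', h'', if_false]
  · push Not at hoff
    have hW : ¬ Wblk P N ≤ p := by have := D_le_Wblk P N; unfold D at this; omega
    have hD : p < D P N := by unfold D; omega
    simp only [cleanW, hW, if_false, hD, if_true, dfun, show ¬ p < N by omega, show p < N + 3 * Wq P N by omega, qOf]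
    have hWq : 0 < Wq P N := by omega
    have e : qW P N ((p - N) / Wq P N) ((p - N) % Wq P N) = p := by
      unfold qW
      have := Nat.div_add_mod (p - N) (Wq P N)
      rw [Nat.mul_comm] at this; omega
    rw [e, liftW_of_lt z hp]

/-- The blocks of `zPreF` are zero. [folklore] -/
theorem zPreF_comp_E (c : Fin 3) : zPreF P S x ∘ E P x c = fun _ => false := by
  funext t
  simp only [Function.comp_apply, zPreF]
  have h1 := qW_lt P N c.isLt t.isLt
  have h2 := N_le_qW P N c t
  have hW : ¬ Wblk P N ≤ qW P N c t := by have := D_le_Wblk P N; unfold D at this; omega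
  have hD : qW P N c t < D P N := by unfold D; omega
  change cleanW P x (dfun P x q0 0 0 false false) (topPre P x S) (qW P N c t) = false
  simp only [cleanW, hW, if_false, hD, if_true, dfun, show ¬ qW P N ↑c ↑t < N by omega, h1, q0]

/-- The masks and the ancilla of `zPreF`. [folklore] -/
theorem zPreF_top {p : ℕ} (hp : p < TW P N) (hW : Wblk P N ≤ p) : zPreF P S x ⟨p, hp⟩ = topPre P x S p := by
  change cleanW P x _ _ p = _; simp [cleanW, hW]

/-- The layer-mask bit `j`. [folklore] -/
theorem zPreF_KW {j : ℕ} (hj : j < Ly P N + 1) :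
    zPreF P S x ⟨KW P N j, top_lt P N (by unfold KW; omega)⟩ = decide (j < S.Kv x) := by
  rw [zPreF_top P S x _ (by unfold KW; omega)]
  simp only [topPre, topF, KW]
  rw [if_neg (by omega), if_pos (by omega)]
  congr 2; omega

/-- The wire-mask bit `t`. [folklore] -/
theorem zPreF_MW {t : ℕ} (ht : t < Wq P N) :
    zPreF P S x ⟨MW P N t, top_lt P N (by unfold MW; omega)⟩ = decide (t < S.Wv x) := by
  rw [zPreF_top P S x _ (by unfold MW; omega)]
  simp only [topPre, topF, MW]
  rw [if_pos (by omega)]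
  congr 2; omega

/-- The control ancilla is clear. [folklore] -/
theorem zPreF_aW : zPreF P S x ⟨aW P N, top_lt P N (by unfold aW; omega)⟩ = false := by
  rw [zPreF_top P S x _ (by unfold aW; omega)]
  simp only [topPre, topF]
  rw [if_neg (by unfold aW; omega), if_neg (by unfold aW; omega)]; simp

/-- The answer flag is clear. [folklore] -/
theorem topPre_oW : topPre P x S (oW P N) = false := by
  simp only [topPre, topF]
  rw [if_neg (by unfold oW; omega), if_neg (by unfold oW; omega), if_neg (by unfold aW oW; omega)]; simp

/-- **The mask stage on the padded input.** [cite: BernsteinVazirani1997, §8] -/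
theorem pre_mulVec (h : ∀ op ∈ ((preC P N).map (ClOp.map (foW P N))).map RtOp.cl, op.WF) :
    (⟨RtOp.compileList (((preC P N).map (ClOp.map (foW P N))).map RtOp.cl) h⟩ : QCircuit cliffordT (TW P N)).toMatrix A *ᵥ
      basisState (padInput x.get (anc P N)) = basisState (zPreF P S x) := by
  rw [compileList_map_cl_mulVec_basisState]
  refine congrArg basisState (funext fun p => ?_)
  have h1 := clEval_map_finOf_apply (TW_pos P N) (preC P N) (preC_lt P N) (padInput x.get (anc P N)) p
  rw [CWrap.liftW_padInput_get, clEval_preC P x S] at h1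
  exact h1

end PreState

/-! ### Plumbing: sequential composition of compiled programs -/

section Plumbing

variable {W : ℕ}

/-- Running a concatenation of programs is running them in sequence. [folklore] -/
theorem compileList_append_mulVec (ops₁ ops₂ : List (RtOp (Fin W))) (h : ∀ op ∈ ops₁ ++ ops₂, op.WF) (v : QReg W → ℂ) :
    (⟨RtOp.compileList (ops₁ ++ ops₂) h⟩ : QCircuit cliffordT W).toMatrix A *ᵥ v =
      (⟨RtOp.compileList ops₂ fun o ho => h o (List.mem_append_right _ ho)⟩ : QCircuit cliffordT W).toMatrix A *ᵥ
        ((⟨RtOp.compileList ops₁ fun o ho => h o (List.mem_append_left _ ho)⟩ : QCircuit cliffordT W).toMatrix A *ᵥ v) := by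
  rw [RtOp.compileList_append, toMatrix_mk_append, Matrix.mulVec_mulVec]

/-- A singleton program. [folklore] -/
theorem compileList_singleton (op : RtOp (Fin W)) (h : ∀ o ∈ [op], o.WF) :
    RtOp.compileList [op] h = op.compile (h op (by simp)) := by
  rw [RtOp.compileList_cons, RtOp.compileList, List.append_nil]

/-- `List.range` as a map of `List.finRange` under `flatMap`. [folklore] -/
theorem flatMap_range_eq_finRange {α : Type*} (k : ℕ) (f : ℕ → List α) :
    (List.range k).flatMap f = (List.finRange k).flatMap fun i => f i.val := by
  rw [range_eq_map_finRange, List.flatMap_map]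

end Plumbing

/-! ### Hadamard layers -/

section HLayers

/-- The Hadamard gates of layer `j` on the wires `ts` of one register: `H_t` for `t < Wv x`, if
`j < Kv x`. [cite: AaronsonAmbainis2018, §3.2 (Fig. 2)] -/
def hSel (j : ℕ) (ts : List (Fin (Wq P N))) : List (QGate cliffordT (Wq P N)) :=
  ts.flatMap fun t => if j < S.Kv x ∧ t.val < S.Wv x then [hOn t] else []

/-- **The matrix of Hadamard layer `j` on one register.** [cite: AaronsonAmbainis2018, §3.2 (Fig. 2)] -/
def Hm (j : ℕ) : Matrix (QReg (Wq P N)) (QReg (Wq P N)) ℂ :=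
  (⟨hSel P S x j (List.finRange (Wq P N))⟩ : QCircuit cliffordT (Wq P N)).toMatrix A

/-- The mask wires and the ancilla are off the blocks. [folklore] -/
theorem offBlocks_of_Wblk_le {p : ℕ} (hp : p < TW P N) (hW : Wblk P N ≤ p) : OffBlocks (E P x) ⟨p, hp⟩ :=
  (offBlocks_iff P x _).2 (Or.inr (by have := D_le_Wblk P N; unfold D at this; simp; omega))

/-- **One masked controlled Hadamard**: Toffoli into the ancilla, `CH`, Toffoli; on the product
state over `zPreF` it applies `H_t` to factor `c` iff layer `j` and wire `t` are active.
[cite: NielsenChuang2010, §4.3] -/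
theorem hGad_mulVec {j : ℕ} (hj : j < Ly P N + 1) (c : Fin 3) (t : Fin (Wq P N)) (φ : Fin 3 → QReg (Wq P N) → ℂ)
    (h : ∀ op ∈ (hGad P N j c.val t.val).map (RtOp.map (foW P N)), op.WF) :
    (⟨RtOp.compileList ((hGad P N j c.val t.val).map (RtOp.map (foW P N))) h⟩ : QCircuit cliffordT (TW P N)).toMatrix A *ᵥ
        prodState (E P x) φ (zPreF P S x) =
      prodState (E P x) (Function.update φ c
        (if j < S.Kv x ∧ t.val < S.Wv x then (hOn t).toMatrix A *ᵥ φ c else φ c)) (zPreF P S x) := by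
  have hT := TW_pos P N
  have hK : KW P N j < TW P N := top_lt P N (by unfold KW; omega)
  have hMw : MW P N t < TW P N := top_lt P N (by unfold MW; omega)
  have ha : aW P N < TW P N := top_lt P N (by unfold aW; omega)
  have hq : qW P N c t < TW P N := lt_TW_of_lt_D P N (qW_lt_D P N c.isLt t.isLt)
  -- the three operations on `Fin TW`
  set tof : ClOp (Fin (TW P N)) := ClOp.toffoli ⟨KW P N j, hK⟩ ⟨MW P N t, hMw⟩ ⟨aW P N, ha⟩ with htof
  have e : (hGad P N j c.val t.val).map (RtOp.map (foW P N)) =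
      [tof].map RtOp.cl ++ ([RtOp.chad ⟨aW P N, ha⟩ (E P x c t)] ++ [tof].map RtOp.cl) := by
    simp [hGad, RtOp.map, ClOp.map, htof, foW, finOf_of_lt hT hK, finOf_of_lt hT hMw, finOf_of_lt hT ha,
      finOf_of_lt hT hq, E]
  have hoff : ∀ op ∈ [tof], ∀ w ∈ wiresOf op, OffBlocks (E P x) w := by
    intro op hop w hw
    simp only [List.mem_singleton] at hop; subst hop
    simp only [htof, mem_wiresOf, ClOp.target, ClOp.controls, List.mem_cons, List.not_mem_nil, or_false] at hw
    rcases hw with rfl | rfl | rfl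
    · exact offBlocks_of_Wblk_le P x _ (by unfold aW; omega)
    · exact offBlocks_of_Wblk_le P x _ (by unfold KW; omega)
    · exact offBlocks_of_Wblk_le P x _ (by unfold MW; omega)
  have hwf : ∀ op ∈ [tof], op.WF := by
    intro op hop; simp only [List.mem_singleton] at hop; subst hop
    refine ⟨?_, ?_, ?_⟩ <;> simp [Fin.ext_iff, KW, MW, aW] <;> omega
  rw [RtOp.compileList_congr e h (fun o ho => h o (e ▸ ho)), compileList_append_mulVec, compileList_append_mulVec]
  -- first Toffoli
  rw [clOps_mulVec_prodState A [tof] hwf hoff _ φ _]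
  -- the controlled Hadamard
  have hctrl : clEval [tof] (zPreF P S x) ⟨aW P N, ha⟩ = decide (j < S.Kv x ∧ t.val < S.Wv x) := by
    simp only [clEval_cons, clEval_nil, htof, ClOp.eval_toffoli, Function.update_self]
    rw [zPreF_aW P S x, zPreF_KW P S x hj, zPreF_MW P S x t.isLt, Bool.false_xor, Bool.decide_and]
  have hne : (⟨aW P N, ha⟩ : Fin (TW P N)) ≠ E P x c t := by
    intro h'; have := congrArg Fin.val h'; simp [aW] at this
    have := qW_lt_D P N c.isLt t.isLt; have := D_le_Wblk P N; omega
  have h2 : ∀ (hh : ∀ o ∈ [RtOp.chad ⟨aW P N, ha⟩ (E P x c t)], o.WF) (ψ : Fin 3 → QReg (Wq P N) → ℂ),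
      (⟨RtOp.compileList [RtOp.chad ⟨aW P N, ha⟩ (E P x c t)] hh⟩ : QCircuit cliffordT (TW P N)).toMatrix A *ᵥ
          prodState (E P x) ψ (clEval [tof] (zPreF P S x)) =
        prodState (E P x) (Function.update ψ c (if j < S.Kv x ∧ t.val < S.Wv x then (hOn t).toMatrix A *ᵥ ψ c else ψ c))
          (clEval [tof] (zPreF P S x)) := by
    intro hh ψ
    rw [compileList_singleton, show (RtOp.chad ⟨aW P N, ha⟩ (E P x c t)).compile (hh _ (by simp)) = chWord ⟨aW P N, ha⟩ (E P x c t) hne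
      from rfl, chWord_mulVec_prodState A (blockDisjoint_E P x) (offBlocks_of_Wblk_le P x ha (by unfold aW; omega)) c t hne ψ _,
      hctrl]
    by_cases hc : j < S.Kv x ∧ t.val < S.Wv x
    · rw [decide_eq_true hc]; simp [hc]
    · rw [decide_eq_false hc]; simp [hc]
  rw [h2]
  -- second Toffoli
  rw [clOps_mulVec_prodState A [tof] hwf hoff _ _ _]
  have hinv : clEval [tof] (clEval [tof] (zPreF P S x)) = zPreF P S x := by
    simp only [clEval_cons, clEval_nil]
    exact ClOp.eval_involutive (hwf tof (by simp)) _
  rw [hinv]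

/-- **A row of masked controlled Hadamards** on one register multiplies its factor by the
selective Hadamard list. [cite: AaronsonAmbainis2018, §3.2 (Fig. 2)] -/
theorem hRow_mulVec {j : ℕ} (hj : j < Ly P N + 1) (c : Fin 3) :
    ∀ (ts : List (Fin (Wq P N))) (φ : Fin 3 → QReg (Wq P N) → ℂ)
      (h : ∀ op ∈ (ts.flatMap fun t => hGad P N j c.val t.val).map (RtOp.map (foW P N)), op.WF),
      (⟨RtOp.compileList ((ts.flatMap fun t => hGad P N j c.val t.val).map (RtOp.map (foW P N))) h⟩ :
          QCircuit cliffordT (TW P N)).toMatrix A *ᵥ prodState (E P x) φ (zPreF P S x) =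
        prodState (E P x) (Function.update φ c
          ((⟨hSel P S x j ts⟩ : QCircuit cliffordT (Wq P N)).toMatrix A *ᵥ φ c)) (zPreF P S x)
  | [], φ, h => by
    simp only [List.flatMap_nil, List.map_nil, hSel]
    rw [show RtOp.compileList ([] : List (RtOp (Fin (TW P N)))) h = [] from rfl, QCircuit.toMatrix_nil, Matrix.one_mulVec,
      QCircuit.toMatrix_nil, Matrix.one_mulVec, Function.update_eq_self]
  | t :: ts, φ, h => by
    have e : ((t :: ts).flatMap fun t => hGad P N j c.val t.val).map (RtOp.map (foW P N)) =
        (hGad P N j c.val t.val).map (RtOp.map (foW P N)) ++ (ts.flatMap fun t => hGad P N j c.val t.val).map (RtOp.map (foW P N)) := by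
      rw [List.flatMap_cons, List.map_append]
    rw [RtOp.compileList_congr e h (fun o ho => h o (e ▸ ho)), compileList_append_mulVec, hGad_mulVec P S x A hj c t φ,
      hRow_mulVec hj c ts]
    congr 1
    rw [Function.update_idem]
    congr 1
    rw [Function.update_self]
    simp only [hSel, List.flatMap_cons]
    rw [toMatrix_mk_append, ← Matrix.mulVec_mulVec]
    congr 1
    split_ifs
    · rw [QCircuit.toMatrix_cons, QCircuit.toMatrix_nil, Matrix.one_mul]
    · rw [QCircuit.toMatrix_nil, Matrix.one_mulVec]

/-- **Hadamard layer `j` multiplies every factor by `Hm j`.** [cite: AaronsonAmbainis2018, §3.2 (Fig. 2)] -/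
theorem hLayer_mulVec {j : ℕ} (hj : j < Ly P N + 1) (φ : Fin 3 → QReg (Wq P N) → ℂ)
    (h : ∀ op ∈ (hLayer P N j).map (RtOp.map (foW P N)), op.WF) :
    (⟨RtOp.compileList ((hLayer P N j).map (RtOp.map (foW P N))) h⟩ : QCircuit cliffordT (TW P N)).toMatrix A *ᵥ
        prodState (E P x) φ (zPreF P S x) =
      prodState (E P x) (fun c => Hm P S x A j *ᵥ φ c) (zPreF P S x) := by
  -- by induction over the list of copies
  suffices hcs : ∀ (cs : List (Fin 3)) (φ : Fin 3 → QReg (Wq P N) → ℂ)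
      (h : ∀ op ∈ (cs.flatMap fun c => (List.finRange (Wq P N)).flatMap fun t => hGad P N j c.val t.val).map (RtOp.map (foW P N)),
        op.WF),
      cs.Nodup →
      (⟨RtOp.compileList ((cs.flatMap fun c => (List.finRange (Wq P N)).flatMap fun t => hGad P N j c.val t.val).map
          (RtOp.map (foW P N))) h⟩ : QCircuit cliffordT (TW P N)).toMatrix A *ᵥ prodState (E P x) φ (zPreF P S x) =
        prodState (E P x) (fun c => if c ∈ cs then Hm P S x A j *ᵥ φ c else φ c) (zPreF P S x) by
    have e : (hLayer P N j).map (RtOp.map (foW P N)) =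
        ((List.finRange 3).flatMap fun c => (List.finRange (Wq P N)).flatMap fun t => hGad P N j c.val t.val).map
          (RtOp.map (foW P N)) := by
      rw [hLayer, flatMap_range_eq_finRange]
      congr 1
      refine List.flatMap_congr fun c _ => ?_
      exact flatMap_range_eq_finRange _ _
    rw [RtOp.compileList_congr e h (fun o ho => h o (e ▸ ho)), hcs _ φ _ (List.nodup_finRange 3)]
    simp
  intro cs
  induction cs with
  | nil =>
    intro φ h _
    simp only [List.flatMap_nil, List.map_nil, List.not_mem_nil, if_false]
    rw [show RtOp.compileList ([] : List (RtOp (Fin (TW P N)))) h = [] from rfl, QCircuit.toMatrix_nil, Matrix.one_mulVec]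
  | cons c cs ih =>
    intro φ h hnd
    have hc : c ∉ cs := (List.nodup_cons.1 hnd).1
    have e : ((c :: cs).flatMap fun c => (List.finRange (Wq P N)).flatMap fun t => hGad P N j c.val t.val).map (RtOp.map (foW P N)) =
        ((List.finRange (Wq P N)).flatMap fun t => hGad P N j c.val t.val).map (RtOp.map (foW P N)) ++
          (cs.flatMap fun c => (List.finRange (Wq P N)).flatMap fun t => hGad P N j c.val t.val).map (RtOp.map (foW P N)) := by
      rw [List.flatMap_cons, List.map_append]
    rw [RtOp.compileList_congr e h (fun o ho => h o (e ▸ ho)), compileList_append_mulVec, hRow_mulVec P S x A hj c,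
      ih _ _ (List.nodup_cons.1 hnd).2]
    congr 1
    funext c'
    by_cases hcc : c' = c
    · subst hcc
      simp [hc, Hm]
    · simp [hcc]

end HLayers

/-! ### Phase layers -/

section PLayers

/-- The sign of the phase predicate of layer `j` on a register content. [cite: AaronsonAmbainis2018, §3.2 (Fig. 2: `U_{f_i}`)] -/
def sgnP (j : ℕ) (y : QReg (Wq P N)) : ℂ := if S.Pf x (List.ofFn y) j then -1 else 1

/-- **The diagonal phase matrix of layer `j`**, `|u⟩ ↦ (-1)^{f_j(u)} |u⟩`. [cite: AaronsonAmbainis2018, §3.2 (Fig. 2)] -/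
def Dg (j : ℕ) : Matrix (QReg (Wq P N)) (QReg (Wq P N)) ℂ := Matrix.diagonal (sgnP P S x j)

/-- `Dg` acts by the sign. [folklore] -/
theorem Dg_mulVec (j : ℕ) (ψ : QReg (Wq P N) → ℂ) : Dg P S x j *ᵥ ψ = fun y => sgnP P S x j y * ψ y := by
  funext y; simp [Dg, Matrix.mulVec_diagonal]

/-- The opening and the closing of the phase macro, transported to `Fin TW`, compose to the
identity. [folklore] -/
theorem clEval_pOpen_pClose_fin {j : ℕ} (hj : j ≤ Ly P N) (c : ℕ) (z : QReg (TW P N)) :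
    clEval ((pClose P N j c).map (ClOp.map (foW P N))) (clEval ((pOpen P N j c).map (ClOp.map (foW P N))) z) = z := by
  have hT := TW_pos P N
  have ho : ∀ op ∈ pOpen P N j c, ∀ i ∈ wiresOf op, i < TW P N :=
    fun op hop i hi => lt_trans (pOpen_lt P N hj c op hop i hi) (Wblk_lt_TW P N)
  have hc : ∀ op ∈ pClose P N j c, ∀ i ∈ wiresOf op, i < TW P N :=
    fun op hop i hi => lt_trans (pClose_lt P N hj c op hop i hi) (Wblk_lt_TW P N)
  funext p
  rw [← liftW_val (clEval _ _) p, foW, liftW_clEval_map hT _ hc, liftW_clEval_map hT _ ho, clEval_pOpen_pClose, liftW_val]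

/-- **The phase macro on a basis state in the support**: the sign of the phase bit of its own
register. [cite: NielsenChuang2010, §6.1.1 (phase oracle from a bit oracle)] -/
theorem pMacro_mulVec_basisState {j : ℕ} (hj1 : 1 ≤ j) (hj : j ≤ Ly P N) (c : Fin 3)
    (h : ∀ op ∈ (pMacro P N j c.val).map (RtOp.map (foW P N)), op.WF) {z : QReg (TW P N)}
    (hz : ∀ w, OffBlocks (E P x) w → z w = zPreF P S x w) :
    (⟨RtOp.compileList ((pMacro P N j c.val).map (RtOp.map (foW P N))) h⟩ : QCircuit cliffordT (TW P N)).toMatrix A *ᵥ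
        basisState z = sgnP P S x j (z ∘ E P x c) • basisState z := by
  have hT := TW_pos P N
  have he : eW P N 0 < TW P N := lt_trans (eW_lt_Wblk P N (by unfold D; omega)) (Wblk_lt_TW P N)
  have e : (pMacro P N j c.val).map (RtOp.map (foW P N)) =
      ((pOpen P N j c.val).map (ClOp.map (foW P N))).map RtOp.cl ++
        (zOps ⟨eW P N 0, he⟩ ++ ((pClose P N j c.val).map (ClOp.map (foW P N))).map RtOp.cl) := by
    simp [pMacro, List.map_map, Function.comp_def, RtOp.map, zOps, foW, finOf_of_lt hT he, ClOp.map]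
  rw [RtOp.compileList_congr e h (fun o ho => h o (e ▸ ho)), compileList_append_mulVec, compileList_append_mulVec,
    compileList_map_cl_mulVec_basisState, compileList_zOps_mulVec_basisState, Matrix.mulVec_smul,
    compileList_map_cl_mulVec_basisState, clEval_pOpen_pClose_fin P x hj]
  congr 1
  -- the phase bit
  have hbit : clEval ((pOpen P N j c.val).map (ClOp.map (foW P N))) z ⟨eW P N 0, he⟩ = S.Pf x (List.ofFn (z ∘ E P x c)) j := by
    have ho : ∀ op ∈ pOpen P N j c.val, ∀ i ∈ wiresOf op, i < TW P N :=
      fun op hop i hi => lt_trans (pOpen_lt P N hj c op hop i hi) (Wblk_lt_TW P N)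
    have := clEval_map_finOf_apply hT (pOpen P N j c.val) ho z ⟨eW P N 0, he⟩
    rw [foW, this]
    change clEval (pOpen P N j c.val) (liftW z) (eW P N 0) = _
    rw [liftW_eq_cleanW_of_agree P S x hz, clEval_pOpen_eW P x S _ hj1 hj c.isLt, qlist_qOf]
  rw [hbit, sgnP]

/-- **The phase macro multiplies its factor by `Dg j`.** [cite: AaronsonAmbainis2018, §3.2 (Fig. 2)] -/
theorem pMacro_mulVec {j : ℕ} (hj1 : 1 ≤ j) (hj : j ≤ Ly P N) (c : Fin 3) (φ : Fin 3 → QReg (Wq P N) → ℂ)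
    (h : ∀ op ∈ (pMacro P N j c.val).map (RtOp.map (foW P N)), op.WF) :
    (⟨RtOp.compileList ((pMacro P N j c.val).map (RtOp.map (foW P N))) h⟩ : QCircuit cliffordT (TW P N)).toMatrix A *ᵥ
        prodState (E P x) φ (zPreF P S x) =
      prodState (E P x) (Function.update φ c (Dg P S x j *ᵥ φ c)) (zPreF P S x) := by
  rw [Dg_mulVec]
  exact mulVec_prodState_of_diag c (sgnP P S x j) φ _ fun z hz => pMacro_mulVec_basisState P S x A hj1 hj c h hz

/-- **The three phase macros of layer `j` multiply every factor by `Dg j`.**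
[cite: AaronsonAmbainis2018, §3.2 (Fig. 2)] -/
theorem pLayer_mulVec {j : ℕ} (hj1 : 1 ≤ j) (hj : j ≤ Ly P N) (φ : Fin 3 → QReg (Wq P N) → ℂ)
    (h : ∀ op ∈ (pLayer P N j).map (RtOp.map (foW P N)), op.WF) :
    (⟨RtOp.compileList ((pLayer P N j).map (RtOp.map (foW P N))) h⟩ : QCircuit cliffordT (TW P N)).toMatrix A *ᵥ
        prodState (E P x) φ (zPreF P S x) =
      prodState (E P x) (fun c => Dg P S x j *ᵥ φ c) (zPreF P S x) := by
  have e : (pLayer P N j).map (RtOp.map (foW P N)) =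
      (pMacro P N j (0 : Fin 3).val).map (RtOp.map (foW P N)) ++ ((pMacro P N j (1 : Fin 3).val).map (RtOp.map (foW P N)) ++
        (pMacro P N j (2 : Fin 3).val).map (RtOp.map (foW P N))) := by
    simp [pLayer]
  rw [RtOp.compileList_congr e h (fun o ho => h o (e ▸ ho)), compileList_append_mulVec, compileList_append_mulVec,
    pMacro_mulVec P S x A hj1 hj, pMacro_mulVec P S x A hj1 hj, pMacro_mulVec P S x A hj1 hj]
  congr 1
  funext c
  fin_cases c <;> simp [Function.update]

end PLayers

/-! ### All layers -/

section Layers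

/-- **The block state after `j` layers**: `φ 0 = |0^{Wq}⟩`, `φ (j+1) = Dg (j+1) · Hm j · φ j`.
[cite: AaronsonAmbainis2018, §3.2 (Fig. 2)] -/
def phi : ℕ → QReg (Wq P N) → ℂ
  | 0 => basisState fun _ => false
  | j + 1 => Dg P S x (j + 1) *ᵥ (Hm P S x A j *ᵥ phi j)

/-- **The final block state** `Hm Ly · φ Ly`: the padded Forrelation circuit applied to `|0^{Wq}⟩`.
[cite: AaronsonAmbainis2018, §3.2 (Fig. 2)] -/
def phiFin : QReg (Wq P N) → ℂ := Hm P S x A (Ly P N) *ᵥ phi P S x A (Ly P N)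

/-- **The layer loop** maps the product of the zero registers to the product of `φ Ly`.
[cite: AaronsonAmbainis2018, §3.2 (Fig. 2)] -/
theorem layers_mulVec_aux : ∀ (k : ℕ), k ≤ Ly P N →
    ∀ (h : ∀ op ∈ (((List.range k).flatMap fun j => hLayer P N j ++ pLayer P N (j + 1)).map (RtOp.map (foW P N))), op.WF),
      (⟨RtOp.compileList (((List.range k).flatMap fun j => hLayer P N j ++ pLayer P N (j + 1)).map (RtOp.map (foW P N))) h⟩ :
          QCircuit cliffordT (TW P N)).toMatrix A *ᵥ prodState (E P x) (fun _ => basisState fun _ => false) (zPreF P S x) =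
        prodState (E P x) (fun _ => phi P S x A k) (zPreF P S x)
  | 0, _, h => by
    rw [show RtOp.compileList _ h = [] from rfl, QCircuit.toMatrix_nil, Matrix.one_mulVec]; rfl
  | k + 1, hk, h => by
    have e : ((List.range (k + 1)).flatMap fun j => hLayer P N j ++ pLayer P N (j + 1)).map (RtOp.map (foW P N)) =
        ((List.range k).flatMap fun j => hLayer P N j ++ pLayer P N (j + 1)).map (RtOp.map (foW P N)) ++
          ((hLayer P N k).map (RtOp.map (foW P N)) ++ (pLayer P N (k + 1)).map (RtOp.map (foW P N))) := by
      rw [List.range_succ, List.flatMap_append, List.flatMap_singleton, List.map_append, List.map_append]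
    rw [RtOp.compileList_congr e h (fun o ho => h o (e ▸ ho)), compileList_append_mulVec, compileList_append_mulVec,
      layers_mulVec_aux k (by omega), hLayer_mulVec P S x A (by omega), pLayer_mulVec P S x A (by omega) hk]
    rfl

/-- **After all layers and the last Hadamard layer every block holds `phiFin`.**
[cite: AaronsonAmbainis2018, §3.2 (Fig. 2)] -/
theorem middle_mulVec (h : ∀ op ∈ (layers P N ++ hLayer P N (Ly P N)).map (RtOp.map (foW P N)), op.WF) :
    (⟨RtOp.compileList ((layers P N ++ hLayer P N (Ly P N)).map (RtOp.map (foW P N))) h⟩ :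
        QCircuit cliffordT (TW P N)).toMatrix A *ᵥ basisState (zPreF P S x) =
      prodState (E P x) (fun _ => phiFin P S x A) (zPreF P S x) := by
  have e : (layers P N ++ hLayer P N (Ly P N)).map (RtOp.map (foW P N)) =
      (layers P N).map (RtOp.map (foW P N)) ++ (hLayer P N (Ly P N)).map (RtOp.map (foW P N)) := List.map_append
  rw [RtOp.compileList_congr e h (fun o ho => h o (e ▸ ho)), compileList_append_mulVec,
    basisState_eq_prodState (E P x) (zPreF P S x)]
  simp only [zPreF_comp_E]
  rw [show (⟨RtOp.compileList ((layers P N).map (RtOp.map (foW P N))) fun o ho => h o (e ▸ List.mem_append_left _ ho)⟩ :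
      QCircuit cliffordT (TW P N)).toMatrix A *ᵥ prodState (E P x) (fun _ => basisState fun _ => false) (zPreF P S x) =
      prodState (E P x) (fun _ => phi P S x A (Ly P N)) (zPreF P S x) from layers_mulVec_aux P S x A (Ly P N) le_rfl _,
    hLayer_mulVec P S x A (Nat.lt_succ_self _)]
  rfl

/-- `‖φ‖² is preserved by the sign matrices. [folklore] -/
theorem normSq_Dg_mulVec (j : ℕ) (ψ : QReg (Wq P N) → ℂ) : normSq (Dg P S x j *ᵥ ψ) = normSq ψ := by
  rw [Dg_mulVec]
  unfold normSq
  refine Finset.sum_congr rfl fun y _ => ?_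
  rw [norm_mul]
  have : ‖sgnP P S x j y‖ = 1 := by unfold sgnP; split_ifs <;> simp
  rw [this, one_mul]

/-- `Hm j` is unitary. [folklore] -/
theorem Hm_mem_unitaryGroup (j : ℕ) : Hm P S x A j ∈ Matrix.unitaryGroup (QReg (Wq P N)) ℂ :=
  QCircuit.toMatrix_mem_unitaryGroup_holds cliffordT_isUnitary_holds A _

/-- The block states are unit vectors. [folklore] -/
theorem normSq_phi : ∀ j, normSq (phi P S x A j) = 1
  | 0 => normSq_basisState _
  | j + 1 => by
    rw [phi, normSq_Dg_mulVec, normSq_mulVec_of_mem_unitaryGroup (Hm_mem_unitaryGroup P S x A j), normSq_phi j]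

/-- The final block state is a unit vector. [folklore] -/
theorem normSq_phiFin : normSq (phiFin P S x A) = 1 := by
  rw [phiFin, normSq_mulVec_of_mem_unitaryGroup (Hm_mem_unitaryGroup P S x A _), normSq_phi]

end Layers

/-! ### The zero test, and the acceptance probability -/

section Accept

/-- The compiled zero test permutes the basis states by `clEval`. [folklore] -/
theorem post_mulVec_basisState (h : ∀ op ∈ ((postC P N).map (ClOp.map (foW P N))).map RtOp.cl, op.WF) (z : QReg (TW P N)) :
    (⟨RtOp.compileList (((postC P N).map (ClOp.map (foW P N))).map RtOp.cl) h⟩ : QCircuit cliffordT (TW P N)).toMatrix A *ᵥ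
      basisState z = basisState (clEval ((postC P N).map (ClOp.map (foW P N))) z) :=
  compileList_map_cl_mulVec_basisState A _ h z

/-- The zero-test permutation is injective. [folklore] -/
theorem post_injective : Function.Injective (clEval ((postC P N).map (ClOp.map (foW P N)))) :=
  clEval_injective _ fun op hop => by
    obtain ⟨op', hop', rfl⟩ := List.mem_map.1 hop
    exact wf_map_finOf (TW_pos P N) (postC_lt P N op' hop') (postC_wf P N op' hop')

/-- **On the support of the product state, wire `0` finally reads `[some register is zero]`.**
[cite: AaronsonAmbainis2018, §6 (p. 26)] -/
theorem post_zero {z : QReg (TW P N)} (hz : ∀ w, OffBlocks (E P x) w → z w = zPreF P S x w) :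
    clEval ((postC P N).map (ClOp.map (foW P N))) z ⟨0, TW_pos P N⟩ = true ↔
      ∃ c : Fin 3, z ∘ E P x c = fun _ => false := by
  rw [foW, clEval_map_finOf_apply (TW_pos P N) _ (postC_lt P N)]
  change clEval (postC P N) (liftW z) 0 = true ↔ _
  rw [liftW_eq_cleanW_of_agree P S x hz, clEval_postC_zero P x S _ _ (topPre_oW P S x)]
  have key : ∀ c : Fin 3, (qlist P x (qOf P x z) c = zeros (Wq P N) ↔ (z ∘ E P x c = fun _ => false)) := by
    intro c
    rw [qlist_qOf, show zeros (Wq P N) = List.ofFn (fun _ : Fin (Wq P N) => false) by simp [List.ofFn_const], List.ofFn_inj]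
  constructor
  · rintro ⟨c, hc, hq⟩
    exact ⟨⟨c, hc⟩, (key ⟨c, hc⟩).1 hq⟩
  · rintro ⟨c, hc⟩
    exact ⟨c, c.isLt, (key c).2 hc⟩

/-- Born weights of `phiFin`: the return-to-zero weight … [folklore] -/
theorem sum_normSq_phiFin_ne :
    (∑ v : QReg (Wq P N), if v = (fun _ => false) then (0 : ℝ) else ‖phiFin P S x A v‖ ^ 2) =
      1 - ‖phiFin P S x A fun _ => false‖ ^ 2 := by
  have h := normSq_phiFin P S x A
  unfold normSq at h
  rw [← Finset.sum_erase_add _ _ (Finset.mem_univ (fun _ : Fin (Wq P N) => false))] at h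
  rw [Finset.sum_ite, Finset.sum_const_zero, zero_add]
  have e : Finset.univ.filter (fun v : QReg (Wq P N) => ¬ v = fun _ => false) = Finset.univ.erase fun _ => false := by
    ext v; simp
  rw [e]; linarith

/-- **The acceptance probability of the circuit is `1 − (1 − |⟨0|phiFin⟩|²)³`** (three independent
runs, accept iff one returns to the all-zero state). [cite: AaronsonAmbainis2018, §6 (p. 26) and Prop. 6] -/
theorem acceptProb_bigCirc :
    (bigCirc P N).acceptProb A x.get = 1 - (1 - ‖phiFin P S x A fun _ => false‖ ^ 2) ^ 3 := by
  have hT := TW_pos P N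
  have hsplit : (allOps P N).map (RtOp.map (foW P N)) =
      ((preC P N).map (ClOp.map (foW P N))).map RtOp.cl ++ ((layers P N ++ hLayer P N (Ly P N)).map (RtOp.map (foW P N)) ++
        ((postC P N).map (ClOp.map (foW P N))).map RtOp.cl) := by
    simp [allOps, pre, post, List.map_map, Function.comp_def, RtOp.map]
  unfold QCircuit.acceptProb
  simp only [hT, dif_pos, QCircuit.runOn]
  unfold bigCirc
  rw [RtOp.compileList_congr hsplit _ (fun op hop => (wf_map_finOf_of hT (allOps_wf P N) (allOps_lt P N)) op (hsplit ▸ hop)),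
    compileList_append_mulVec, compileList_append_mulVec, pre_mulVec P S x A, middle_mulVec P S x A]
  -- the zero test permutes the Born weights
  have hperm := sum_ite_normSq_mulVec_of_perm (W := TW P N) ⟨_, post_injective P x⟩
    (post_mulVec_basisState P x A (fun o ho => (wf_map_finOf_of hT (allOps_wf P N) (allOps_lt P N)) o
      (hsplit ▸ List.mem_append_right _ (List.mem_append_right _ ho))))
    (prodState (E P x) (fun _ => phiFin P S x A) (zPreF P S x)) (fun y => y ⟨0, hT⟩ = true)
  rw [hperm]
  have hsupp : ∀ z, (if (⟨_, post_injective P x⟩ : QReg (TW P N) ↪ QReg (TW P N)) z ⟨0, hT⟩ = true then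
      ‖prodState (E P x) (fun _ => phiFin P S x A) (zPreF P S x) z‖ ^ 2 else 0) =
      ‖prodState (E P x) (fun _ => phiFin P S x A) (zPreF P S x) z‖ ^ 2 *
        (if ∃ c : Fin 3, z ∘ E P x c = fun _ => false then (1 : ℝ) else 0) := by
    intro z
    rw [Function.Embedding.coeFn_mk]
    by_cases hz : ∀ w, OffBlocks (E P x) w → z w = zPreF P S x w
    · simp only [post_zero P S x hz]
      split <;> simp
    · have h0 : prodState (E P x) (fun _ => phiFin P S x A) (zPreF P S x) z = 0 := by
        rw [prodState_apply, if_neg hz, zero_mul]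
      simp [h0]
  rw [Finset.sum_congr rfl fun z _ => hsupp z,
    sum_normSq_prodState_mul (blockDisjoint_E P x) _ _ (fun y => if ∃ c : Fin 3, y c = fun _ => false then (1 : ℝ) else 0)]
  -- `[∃ c, y c = 0] = 1 - ∏ [y c ≠ 0]`
  have hg' : ∀ y : Fin 3 → QReg (Wq P N),
      (∏ c, ‖phiFin P S x A (y c)‖ ^ 2) * (if ∃ c : Fin 3, y c = fun _ => false then (1 : ℝ) else 0) =
        (∏ c, ‖phiFin P S x A (y c)‖ ^ 2) - ∏ c, (if y c = (fun _ => false) then 0 else ‖phiFin P S x A (y c)‖ ^ 2) := by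
    intro y
    by_cases hex : ∃ c : Fin 3, y c = fun _ => false
    · rw [if_pos hex, mul_one]
      obtain ⟨c, hc⟩ := hex
      have h0 : (∏ c, (if y c = (fun _ => false) then 0 else ‖phiFin P S x A (y c)‖ ^ 2)) = 0 :=
        Finset.prod_eq_zero (Finset.mem_univ c) (by rw [if_pos hc])
      rw [h0, sub_zero]
    · rw [if_neg hex, mul_zero, eq_comm, sub_eq_zero]
      refine Finset.prod_congr rfl fun c _ => ?_
      rw [if_neg (fun hc => hex ⟨c, hc⟩)]
  rw [Finset.sum_congr rfl fun y _ => hg' y, Finset.sum_sub_distrib]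
  have h1 : (∑ y : Fin 3 → QReg (Wq P N), ∏ c, ‖phiFin P S x A (y c)‖ ^ 2) = 1 := by
    have := Finset.prod_univ_sum (fun _ : Fin 3 => (Finset.univ : Finset (QReg (Wq P N)))) (fun _ v => ‖phiFin P S x A v‖ ^ 2)
    rw [Fintype.piFinset_univ] at this
    rw [← this]
    have hn : (∑ v, ‖phiFin P S x A v‖ ^ 2) = 1 := normSq_phiFin P S x A
    simp [hn]
  have h2 : (∑ y : Fin 3 → QReg (Wq P N), ∏ c, (if y c = (fun _ => false) then 0 else ‖phiFin P S x A (y c)‖ ^ 2)) =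
      (1 - ‖phiFin P S x A fun _ => false‖ ^ 2) ^ 3 := by
    have := Finset.prod_univ_sum (fun _ : Fin 3 => (Finset.univ : Finset (QReg (Wq P N))))
      (fun _ v => if v = (fun _ => false) then 0 else ‖phiFin P S x A v‖ ^ 2)
    rw [Fintype.piFinset_univ] at this
    rw [← this, Finset.prod_const, Finset.card_univ, Fintype.card_fin, sum_normSq_phiFin_ne P S x A]
  rw [h1, h2]

/-- **The acceptance probability of the family.** [cite: AaronsonAmbainis2018, §6 (p. 26) and Prop. 6] -/
theorem acceptProbOn_family :
    (family P).acceptProbOn A x = 1 - (1 - ‖phiFin P S x A fun _ => false‖ ^ 2) ^ 3 :=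
  acceptProb_bigCirc P S x A

end Accept

end PhaseQuery

end Literature.Computability.QuantumComplexity
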